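import Summits.CriticalPhenomena.PercolationContinuityZ3.Theorems.PercNearOneGluingNoHeavyLowerTailCertProd
import HarnessLib

/-!
# `NoHeavyLowerTail` (stmt-CriticalPhenomena-4575) — certificate machine add-on: product-form certificates with
# HYP×ROW columns (product of a linear hypothesis row and a product row)

Support file (new-inequality factory, all-graph proof seat `prim-ineq-prove-4`; `--supports stmt-CriticalPhenomena-4575`).
Computable definitions + soundness; no named facts, no sorries, standard axioms.

The `wf3lp` column generation also prices columns `hyprow = (E_hi − E_lo) · (E₃E₄ − E₁E₂) · m` (a linear hypothesis row
times a valid product row times a product-of-masses multiplier `m`): nonnegative because both factors are.  Expanded,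
such a column contributes `E_hi E₃E₄ m + E_lo E₁E₂ m` to the plus side and `E_hi E₁E₂ m + E_lo E₃E₄ m` to the minus side.
This file adds them to the product-form checker of `…CertProd`:
* `PHRow` — the data; `pPlusTermsH` / `pMinusTermsH` / `checkPH` / `checkPHB`;
* `soundPH`, `soundPH_of_buckets` — rows, linear rows and the two factors of every hyp×row valid, check passes ⇒
  `0 ≤ pM0val · pval`.
-/

namespace Summit.CriticalPhenomena.PercolationContinuityZ3.Theorems

namespace CertCheck

/-- A hyp×row column: `(E_hi − E_lo) · (E₃E₄ − E₁E₂) · wt · Π mult`. [folklore] -/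
structure PHRow where
  /-- smaller side of the linear factor -/
  eLo : List ℕ
  /-- larger side of the linear factor -/
  eHi : List ℕ
  /-- cells of `E₁` -/
  e1 : List ℕ
  /-- cells of `E₂` -/
  e2 : List ℕ
  /-- cells of `E₃` -/
  e3 : List ℕ
  /-- cells of `E₄` -/
  e4 : List ℕ
  /-- multiplier: product of linear forms -/
  mult : List (List ℕ)
  /-- weight -/
  wt : ℕ
  deriving DecidableEq, Repr

/-- Plus side with hyp×row columns. [folklore] -/
def pPlusTermsH (M0 : List (List (List ℕ) × ℕ)) (F : List PTerm) (rows : List PRow) (lrows : List PLinRow)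
    (hrows : List PHRow) : List Term :=
  pPlusTerms M0 F rows lrows ++ hrows.flatMap fun r =>
    prodTerms (r.eHi :: r.e3 :: r.e4 :: r.mult) [] r.wt ++ prodTerms (r.eLo :: r.e1 :: r.e2 :: r.mult) [] r.wt

/-- Minus side with hyp×row columns. [folklore] -/
def pMinusTermsH (M0 : List (List (List ℕ) × ℕ)) (F : List PTerm) (rows : List PRow) (lrows : List PLinRow)
    (hrows : List PHRow) : List Term :=
  pMinusTerms M0 F rows lrows ++ hrows.flatMap fun r =>
    prodTerms (r.eHi :: r.e1 :: r.e2 :: r.mult) [] r.wt ++ prodTerms (r.eLo :: r.e3 :: r.e4 :: r.mult) [] r.wt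

/-- THE CHECK with hyp×row columns. [folklore] -/
def checkPH (M0 : List (List (List ℕ) × ℕ)) (F : List PTerm) (rows : List PRow) (lrows : List PLinRow)
    (hrows : List PHRow) : Bool :=
  dominated (normalize (pPlusTermsH M0 F rows lrows hrows)) (normalize (pMinusTermsH M0 F rows lrows hrows))

/-- The bucketed check with hyp×row columns. [folklore] -/
def checkPHB (nb b : ℕ) (M0 : List (List (List ℕ) × ℕ)) (F : List PTerm) (rows : List PRow) (lrows : List PLinRow)
    (hrows : List PHRow) : Bool :=
  dominated (normalize ((pPlusTermsH M0 F rows lrows hrows).filter fun t => bucket nb t == b))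
    (normalize ((pMinusTermsH M0 F rows lrows hrows).filter fun t => bucket nb t == b))

variable (x : ℕ → ℝ)

/-- Value of one expanded hyp×row side. [folklore] -/
theorem evalT_hrow_side (r : PHRow) (a b c : List ℕ) :
    evalT x (prodTerms (a :: b :: c :: r.mult) [] r.wt) =
      (r.wt : ℝ) * prodEval x r.mult * (linEval x a * (linEval x b * linEval x c)) := by
  rw [evalT_prodTerms, prodEval_cons, prodEval_cons, prodEval_cons]
  simp [evalM]
  ring

/-- The hyp×row inequality: `E_hi E₁E₂ + E_lo E₃E₄ ≤ E_hi E₃E₄ + E_lo E₁E₂`. [folklore] -/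
theorem hrow_ineq (hx : ∀ i, 0 ≤ x i) (r : PHRow) (hlin : linEval x r.eLo ≤ linEval x r.eHi)
    (hrow : linEval x r.e1 * linEval x r.e2 ≤ linEval x r.e3 * linEval x r.e4) :
    evalT x (prodTerms (r.eHi :: r.e1 :: r.e2 :: r.mult) [] r.wt ++ prodTerms (r.eLo :: r.e3 :: r.e4 :: r.mult) [] r.wt) ≤
      evalT x (prodTerms (r.eHi :: r.e3 :: r.e4 :: r.mult) [] r.wt ++ prodTerms (r.eLo :: r.e1 :: r.e2 :: r.mult) [] r.wt) := by
  rw [evalT_append, evalT_append, evalT_hrow_side, evalT_hrow_side, evalT_hrow_side, evalT_hrow_side]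
  have hm : 0 ≤ (r.wt : ℝ) * prodEval x r.mult := mul_nonneg (Nat.cast_nonneg _) (prodEval_nonneg x hx _)
  have key : 0 ≤ (linEval x r.eHi - linEval x r.eLo) * (linEval x r.e3 * linEval x r.e4 - linEval x r.e1 * linEval x r.e2) :=
    mul_nonneg (by linarith) (by linarith)
  nlinarith [mul_nonneg hm key]

/-- From the values: domination + valid rows ⇒ `0 ≤ M₀ · F` (hyp×row version). [folklore] -/
theorem le_of_evalT_PH_le (hx : ∀ i, 0 ≤ x i) (M0 : List (List (List ℕ) × ℕ)) (F : List PTerm)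
    (rows : List PRow) (lrows : List PLinRow) (hrows : List PHRow)
    (hr : ∀ r ∈ rows, linEval x r.e1 * linEval x r.e2 ≤ linEval x r.e3 * linEval x r.e4)
    (hl : ∀ r ∈ lrows, linEval x r.eLo ≤ linEval x r.eHi)
    (hh : ∀ r ∈ hrows, linEval x r.eLo ≤ linEval x r.eHi ∧ linEval x r.e1 * linEval x r.e2 ≤ linEval x r.e3 * linEval x r.e4)
    (hdom : evalT x (pPlusTermsH M0 F rows lrows hrows) ≤ evalT x (pMinusTermsH M0 F rows lrows hrows)) :
    0 ≤ pM0val x M0 * pval x F := by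
  unfold pPlusTermsH pMinusTermsH at hdom
  rw [evalT_append, evalT_append, evalT_flatMap, evalT_flatMap] at hdom
  have hH : (hrows.map fun r => evalT x (prodTerms (r.eHi :: r.e1 :: r.e2 :: r.mult) [] r.wt ++
      prodTerms (r.eLo :: r.e3 :: r.e4 :: r.mult) [] r.wt)).sum ≤
      (hrows.map fun r => evalT x (prodTerms (r.eHi :: r.e3 :: r.e4 :: r.mult) [] r.wt ++
      prodTerms (r.eLo :: r.e1 :: r.e2 :: r.mult) [] r.wt)).sum := by
    apply List.sum_le_sum
    intro r hr'
    exact hrow_ineq x hx r (hh r hr').1 (hh r hr').2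
  apply le_of_evalT_P_le x hx M0 F rows lrows hr hl
  linarith

/-- **Soundness of the check with hyp×row columns.** [folklore] -/
theorem soundPH (hx : ∀ i, 0 ≤ x i) (M0 : List (List (List ℕ) × ℕ)) (F : List PTerm)
    (rows : List PRow) (lrows : List PLinRow) (hrows : List PHRow)
    (hr : ∀ r ∈ rows, linEval x r.e1 * linEval x r.e2 ≤ linEval x r.e3 * linEval x r.e4)
    (hl : ∀ r ∈ lrows, linEval x r.eLo ≤ linEval x r.eHi)
    (hh : ∀ r ∈ hrows, linEval x r.eLo ≤ linEval x r.eHi ∧ linEval x r.e1 * linEval x r.e2 ≤ linEval x r.e3 * linEval x r.e4)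
    (h : checkPH M0 F rows lrows hrows = true) : 0 ≤ pM0val x M0 * pval x F := by
  have hdom := evalT_le_of_dominated x hx _ _ h
  rw [evalT_normalize, evalT_normalize] at hdom
  exact le_of_evalT_PH_le x hx M0 F rows lrows hrows hr hl hh hdom

/-- **Soundness of the bucketed check with hyp×row columns.** [folklore] -/
theorem soundPH_of_buckets (hx : ∀ i, 0 ≤ x i) (M0 : List (List (List ℕ) × ℕ)) (F : List PTerm)
    (rows : List PRow) (lrows : List PLinRow) (hrows : List PHRow) {nb : ℕ} (hnb : 0 < nb)
    (hr : ∀ r ∈ rows, linEval x r.e1 * linEval x r.e2 ≤ linEval x r.e3 * linEval x r.e4)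
    (hl : ∀ r ∈ lrows, linEval x r.eLo ≤ linEval x r.eHi)
    (hh : ∀ r ∈ hrows, linEval x r.eLo ≤ linEval x r.eHi ∧ linEval x r.e1 * linEval x r.e2 ≤ linEval x r.e3 * linEval x r.e4)
    (h : ∀ b < nb, checkPHB nb b M0 F rows lrows hrows = true) : 0 ≤ pM0val x M0 * pval x F := by
  have hdom : evalT x (pPlusTermsH M0 F rows lrows hrows) ≤ evalT x (pMinusTermsH M0 F rows lrows hrows) := by
    rw [evalT_eq_sum_buckets x hnb (pPlusTermsH M0 F rows lrows hrows),
      evalT_eq_sum_buckets x hnb (pMinusTermsH M0 F rows lrows hrows)]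
    apply List.sum_le_sum
    intro b hb
    have hc := h b (List.mem_range.1 hb)
    have := evalT_le_of_dominated x hx _ _ hc
    rwa [evalT_normalize, evalT_normalize] at this
  exact le_of_evalT_PH_le x hx M0 F rows lrows hrows hr hl hh hdom

end CertCheck

end Summit.CriticalPhenomena.PercolationContinuityZ3.Theorems
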